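import Summits.ResolutionOfSingularities.ResolutionOfSingularities.Theorems.PurelyInseparableDim4RidgeBudget
import Summits.ResolutionOfSingularities.ResolutionOfSingularities.Theorems.PurelyInseparableDim4IsolationBudget
import HarnessLib

/-!
# [OURS · res-dim4-pi] `μ⁺` AS A LETTER — the colength calculus of `RidgeBudget.jetColength` / `IsCert`,
  and the SPAN LEMMA (the colength half of (N1⁺) «narrow edges drop `μ⁺`»)

Cell `res-dim4-pi` (D-0157 DOOR 2), seat `res-dim4-p-3` (g2), desk WORD #46 (a).  Supplier file for the
(N1) NARROW LINE of CARD I-3-10 (idea-3; hand proofs `iso6/N1-PROOF-v2.md` 6e04c713 and crit-4 V-A4-09;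
assembly p-1 g2, L2 p-5 g2, L3 p-7 g2): everything here is commutative / linear algebra in
`A = K[x₁..x₄]` over the frame's `originIdeal` (`𝔪₀`), `singLocusIdeal` (`J_q⁺`), p-3's certificate
toolkit (`IsolationCert*`, PR-10) and idea-3's `RidgeBudget.jetColength q N F = dim_K A ⧸ (J_q⁺(F) + 𝔪₀ᴺ)`,
`RidgeBudget.IsCert q N F : 𝔪₀ᴺ ≤ J_q⁺(F) + 𝔪₀ᴺ⁺¹` (p659279).  No frame dynamics (`step`, charts) occur.

## What is proved

* §1 (`𝔪₀`-filtration along one coordinate) `originIdeal_pow_le_span_pow_sup`: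
  `𝔪₀ ≤ (x_j) + J + 𝔪₀² ⇒ 𝔪₀ⁿ ≤ (x_jⁿ) + J + 𝔪₀ⁿ⁺¹` for every `n`; `top_le_span_pow_sup`: then
  `A = K·1 + K·x_j + ⋯ + K·x_jⁿ⁻¹ + (J + 𝔪₀ⁿ)` for every `n` (the local algebra is CURVILINEAR along `x_j`).
* §2 **THE SPAN LEMMA** `finrank_quotient_le_of_X_pow_mem`: if moreover `x_jᵏ ∈ J + 𝔪₀ᴺ` then
  `dim_K A ⧸ (J + 𝔪₀ᴺ) ≤ k`; its `ē = 0` twin `finrank_quotient_le_one_of_le_sup_sq`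
  (`𝔪₀ ≤ J + 𝔪₀² ⇒ dim_K A ⧸ (J + 𝔪₀ᴺ) ≤ 1`); and the lower bound `two_le_finrank_quotient_of_certificate`
  (`J ≤ 𝔪₀`, `𝔪₀ ≰ J + 𝔪₀²`, `N` a certificate level ⇒ `2 ≤ dim_K A ⧸ (J + 𝔪₀ᴺ)`).
* §3 (division by `x_j` against the monomial ideal `𝔪₀ᴹ`) `mem_originIdeal_pow_of_X_mul_mem`,
  `X_pow_mem_sup_pow_of_succ_mem` (`x_jᵏ⁺¹ ∈ x_j·J + 𝔪₀ᴹ⁺¹ ⇒ x_jᵏ ∈ J + 𝔪₀ᴹ`) — the bookkeeping step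
  between L2 (pullback containment) and the colength comparison in (N1⁺).
* §4 the same in `μ⁺`-vocabulary: `isCert_mono`, `jetColength_eq_of_isCert` /
  `jetColength_eq_of_isCert_of_isCert` (**`μ⁺` does not depend on the certificate level** — `NarrowDrop`
  reads it at arbitrary levels `N, N'`), `isCert_jetColength` (`μ⁺` is itself a certificate level),
  `exists_isCert_of_isIsolated` / `isIsolated_of_isCert`, `jetColength_le_of_X_pow_mem`,
  `jetColength_le_one_of_le_sup_sq`, `two_le_jetColength`.

[OURS · counted 0 · elementary commutative/linear algebra; AI kernel work, weaker than expert review.]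
Nothing here is a statement about resolution of singularities; resolution in dimension `≥ 4` /
characteristic `p > 0` is NOT proved by anything in this file.  Host item (DR-157-C):
`stmt-ResolutionOfSingularities-16155`, helper.
-/

noncomputable section

set_option linter.dupNamespace false -- mandated namespace of this single-conjunct summit

open MvPolynomial Finset
open scoped BigOperators

namespace Summit.ResolutionOfSingularities.ResolutionOfSingularities.Theorems.PIDim4.RidgeBudget

open IsolationCert

variable {K : Type} [Field K]

/-! ## §1 The `𝔪₀`-filtration along one coordinate -/

/-- An element minus its constant term lies in `𝔪₀`. OURS (bookkeeping).
[cite: AtiyahMacdonald1969, Ch. 1 Ex. 1.1 (the ideal (x₁,…,xₙ))] -/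
theorem sub_C_constantCoeff_mem_originIdeal (r : MvPolynomial (Fin 4) K) :
    r - C (constantCoeff r) ∈ originIdeal K := by
  rw [originIdeal_eq_idealOfVars,
    Literature.RingTheory.MvPolynomial.mem_idealOfVars_iff_constantCoeff_eq_zero, map_sub,
    constantCoeff_C, sub_self]

/-- **Filtration step.** `𝔪₀ ≤ (x_j) + J + 𝔪₀²` gives `𝔪₀ⁿ ≤ (x_jⁿ) + J + 𝔪₀ⁿ⁺¹` for every `n`
(induction: `𝔪₀·(x_jⁿ) ≤ (x_jⁿ⁺¹) + J + 𝔪₀²·𝔪₀ⁿ`). OURS (elementary).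
[cite: AtiyahMacdonald1969, Prop. 2.6 / Cor. 2.7 (Nakayama's lemma)] -/
theorem originIdeal_pow_le_span_pow_sup {J : Ideal (MvPolynomial (Fin 4) K)} {j : Fin 4}
    (hm : originIdeal K ≤ Ideal.span {(X j : MvPolynomial (Fin 4) K)} ⊔ J ⊔ originIdeal K ^ 2)
    (n : ℕ) :
    originIdeal K ^ n ≤
      Ideal.span {(X j : MvPolynomial (Fin 4) K) ^ n} ⊔ J ⊔ originIdeal K ^ (n + 1) := by
  induction n with
  | zero => simp [Ideal.span_singleton_one, Ideal.one_eq_top]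
  | succ n ih =>
    have hX : (X j : MvPolynomial (Fin 4) K) ^ n ∈ originIdeal K ^ n :=
      Ideal.pow_mem_pow (IsolatedScope.X_mem_originIdeal j) n
    have h1 : originIdeal K * Ideal.span {(X j : MvPolynomial (Fin 4) K) ^ n} ≤
        Ideal.span {(X j : MvPolynomial (Fin 4) K) ^ (n + 1)} ⊔ J ⊔ originIdeal K ^ (n + 1 + 1) := by
      refine (Ideal.mul_mono_left hm).trans ?_
      rw [Ideal.sup_mul, Ideal.sup_mul, Ideal.span_singleton_mul_span_singleton, ← pow_succ']
      refine sup_le (sup_le (le_sup_left.trans le_sup_left)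
        (Ideal.mul_le_right.trans (le_sup_right.trans le_sup_left))) ?_
      refine (Ideal.mul_mono_right ((Ideal.span_singleton_le_iff_mem _).mpr hX)).trans ?_
      rw [← pow_add, show 2 + n = n + 1 + 1 by ring]
      exact le_sup_right
    calc originIdeal K ^ (n + 1) = originIdeal K * originIdeal K ^ n := pow_succ' _ n
      _ ≤ originIdeal K * (Ideal.span {(X j : MvPolynomial (Fin 4) K) ^ n} ⊔ J ⊔
            originIdeal K ^ (n + 1)) := Ideal.mul_mono_right ih
      _ = originIdeal K * Ideal.span {(X j : MvPolynomial (Fin 4) K) ^ n} ⊔ originIdeal K * J ⊔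
            originIdeal K * originIdeal K ^ (n + 1) := by rw [Ideal.mul_sup, Ideal.mul_sup]
      _ ≤ Ideal.span {(X j : MvPolynomial (Fin 4) K) ^ (n + 1)} ⊔ J ⊔
            originIdeal K ^ (n + 1 + 1) := by
          refine sup_le (sup_le h1 ?_) ?_
          · exact Ideal.mul_le_left.trans (le_sup_right.trans le_sup_left)
          · rw [← pow_succ']
            exact le_sup_right

/-- **Curvilinear spanning.** If `𝔪₀ ≤ (x_j) + J + 𝔪₀²` then for every `n` the `K`-space `A` is
`K·1 + K·x_j + ⋯ + K·x_jⁿ⁻¹ + (J + 𝔪₀ⁿ)`: the quotient `A ⧸ (J + 𝔪₀ⁿ)` is spanned by the powers of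
`x_j` below `n`. OURS (elementary). [cite: AtiyahMacdonald1969, Prop. 2.6 / Cor. 2.7 (Nakayama's lemma)] -/
theorem top_le_span_pow_sup {J : Ideal (MvPolynomial (Fin 4) K)} {j : Fin 4}
    (hm : originIdeal K ≤ Ideal.span {(X j : MvPolynomial (Fin 4) K)} ⊔ J ⊔ originIdeal K ^ 2)
    (n : ℕ) :
    (⊤ : Submodule K (MvPolynomial (Fin 4) K)) ≤
      Submodule.span K ((fun i : ℕ => (X j : MvPolynomial (Fin 4) K) ^ i) '' Set.Iio n) ⊔
        (J ⊔ originIdeal K ^ n).restrictScalars K := by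
  induction n with
  | zero =>
    intro g _
    refine Submodule.mem_sup_right ?_
    rw [Submodule.restrictScalars_mem, pow_zero, Ideal.one_eq_top, sup_top_eq]
    exact Submodule.mem_top
  | succ n ih =>
    intro g _
    obtain ⟨s, hs, t, ht, rfl⟩ := Submodule.mem_sup.mp (ih (Submodule.mem_top : g ∈ ⊤))
    rw [Submodule.restrictScalars_mem] at ht
    obtain ⟨a, ha, b, hb, rfl⟩ := Submodule.mem_sup.mp ht
    obtain ⟨rb, hrb, b', hb', rfl⟩ := Submodule.mem_sup.mp (originIdeal_pow_le_span_pow_sup hm n hb)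
    obtain ⟨r1, hr1, a', ha', rfl⟩ := Submodule.mem_sup.mp hrb
    obtain ⟨r, rfl⟩ := Ideal.mem_span_singleton'.mp hr1
    set c : K := constantCoeff r with hc
    have key : s + (a + (r * (X j : MvPolynomial (Fin 4) K) ^ n + a' + b')) =
        (s + C c * X j ^ n) + (a + a' + ((r - C c) * X j ^ n + b')) := by ring
    rw [key]
    refine Submodule.add_mem _ (Submodule.mem_sup_left ?_) (Submodule.mem_sup_right ?_)
    · refine Submodule.add_mem _ (Submodule.span_mono ?_ hs) ?_
      · exact Set.image_mono (Set.Iio_subset_Iio (Nat.le_succ n))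
      · rw [← smul_eq_C_mul]
        exact Submodule.smul_mem _ c
          (Submodule.subset_span ⟨n, Set.mem_Iio.mpr (Nat.lt_succ_self n), rfl⟩)
    · rw [Submodule.restrictScalars_mem]
      refine Submodule.add_mem _ (Submodule.mem_sup_left (J.add_mem ha ha'))
        (Submodule.mem_sup_right (Submodule.add_mem _ ?_ hb'))
      rw [pow_succ']
      exact Ideal.mul_mem_mul (sub_C_constantCoeff_mem_originIdeal r)
        (Ideal.pow_mem_pow (IsolatedScope.X_mem_originIdeal j) n)

/-! ## §2 The SPAN LEMMA and its twins -/

/-- A quotient `A ⧸ I` whose classes of `v 0, …, v (k-1)` span it has `dim_K ≤ k`. OURS (linear algebra).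
[cite: AtiyahMacdonald1969, Prop. 6.9 (length is additive)] -/
theorem finrank_quotient_le_of_top_le_span_sup {I : Ideal (MvPolynomial (Fin 4) K)} {k : ℕ}
    (v : Fin k → MvPolynomial (Fin 4) K)
    (h : (⊤ : Submodule K (MvPolynomial (Fin 4) K)) ≤
      Submodule.span K (Set.range v) ⊔ I.restrictScalars K) :
    Module.finrank K (MvPolynomial (Fin 4) K ⧸ I) ≤ k := by
  have hf : Function.Surjective
      ((Ideal.Quotient.mkₐ K I).toLinearMap ∘ₗ Fintype.linearCombination K v) := by
    intro x
    obtain ⟨g, rfl⟩ := Ideal.Quotient.mkₐ_surjective K I x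
    obtain ⟨s, hs, t, ht, hst⟩ := Submodule.mem_sup.mp (h (Submodule.mem_top : g ∈ ⊤))
    rw [← Fintype.range_linearCombination, LinearMap.mem_range] at hs
    obtain ⟨c, hc⟩ := hs
    rw [Submodule.restrictScalars_mem] at ht
    refine ⟨c, ?_⟩
    change Ideal.Quotient.mk I (Fintype.linearCombination K v c) = Ideal.Quotient.mk I g
    rw [← hst, hc, map_add, Ideal.Quotient.eq_zero_iff_mem.mpr ht, add_zero]
  calc Module.finrank K (MvPolynomial (Fin 4) K ⧸ I)
      = Module.finrank K (⊤ : Submodule K (MvPolynomial (Fin 4) K ⧸ I)) := (finrank_top K _).symm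
    _ = Module.finrank K (LinearMap.range
          ((Ideal.Quotient.mkₐ K I).toLinearMap ∘ₗ Fintype.linearCombination K v)) := by
        rw [LinearMap.range_eq_top.mpr hf]
    _ ≤ Module.finrank K (Fin k → K) := LinearMap.finrank_range_le _
    _ = k := Module.finrank_fin_fun K

/-- **THE SPAN LEMMA** (colength half of (N1⁺)). If `𝔪₀ ≤ (x_j) + J + 𝔪₀²` and `x_jᵏ ∈ J + 𝔪₀ᴺ`, then
`dim_K A ⧸ (J + 𝔪₀ᴺ) ≤ k` (the classes of `1, x_j, …, x_jᵏ⁻¹` span). OURS (elementary).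
[cite: AtiyahMacdonald1969, Prop. 2.6 / Cor. 2.7 (Nakayama's lemma)] -/
theorem finrank_quotient_le_of_X_pow_mem {J : Ideal (MvPolynomial (Fin 4) K)} {j : Fin 4} {k N : ℕ}
    (hm : originIdeal K ≤ Ideal.span {(X j : MvPolynomial (Fin 4) K)} ⊔ J ⊔ originIdeal K ^ 2)
    (hk : (X j : MvPolynomial (Fin 4) K) ^ k ∈ J ⊔ originIdeal K ^ N) :
    Module.finrank K (MvPolynomial (Fin 4) K ⧸ (J ⊔ originIdeal K ^ N)) ≤ k := by
  have hpow : ∀ i, k ≤ i → (X j : MvPolynomial (Fin 4) K) ^ i ∈ J ⊔ originIdeal K ^ N := by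
    intro i hi
    obtain ⟨d, rfl⟩ := Nat.exists_eq_add_of_le hi
    rw [pow_add]
    exact Ideal.mul_mem_right _ _ hk
  refine finrank_quotient_le_of_top_le_span_sup
    (fun i : Fin k => (X j : MvPolynomial (Fin 4) K) ^ (i : ℕ)) ((top_le_span_pow_sup hm N).trans
      (sup_le ?_ le_sup_right))
  rw [Submodule.span_le]
  rintro _ ⟨i, -, rfl⟩
  by_cases hik : i < k
  · exact Submodule.mem_sup_left (Submodule.subset_span ⟨⟨i, hik⟩, rfl⟩)
  · refine Submodule.mem_sup_right ?_
    show (X j : MvPolynomial (Fin 4) K) ^ i ∈ (J ⊔ originIdeal K ^ N).restrictScalars K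
    exact hpow i (not_lt.mp hik)

/-- `𝔪₀ ≤ J + 𝔪₀²` gives `𝔪₀ ≤ J + 𝔪₀ⁿ⁺¹` for every `n`. OURS (elementary).
[cite: AtiyahMacdonald1969, Prop. 2.6 / Cor. 2.7 (Nakayama's lemma)] -/
theorem originIdeal_le_sup_pow_succ_of_le_sup_sq {J : Ideal (MvPolynomial (Fin 4) K)}
    (hm : originIdeal K ≤ J ⊔ originIdeal K ^ 2) (n : ℕ) : originIdeal K ≤ J ⊔ originIdeal K ^ (n + 1) := by
  induction n with
  | zero => exact hm.trans (sup_le_sup_left (Ideal.pow_le_pow_right (by norm_num)) J)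
  | succ n ih =>
    have h : originIdeal K ^ (n + 1) ≤ J ⊔ originIdeal K ^ (n + 1 + 1) := by
      calc originIdeal K ^ (n + 1) = originIdeal K ^ n * originIdeal K := pow_succ _ n
        _ ≤ originIdeal K ^ n * (J ⊔ originIdeal K ^ 2) := Ideal.mul_mono_right hm
        _ = originIdeal K ^ n * J ⊔ originIdeal K ^ n * originIdeal K ^ 2 := Ideal.mul_sup _ _ _
        _ ≤ J ⊔ originIdeal K ^ (n + 1 + 1) := by
            rw [← pow_add]
            exact sup_le_sup Ideal.mul_le_left le_rfl
    exact ih.trans (sup_le le_sup_left h)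

/-- **The `ē = 0` twin.** `𝔪₀ ≤ J + 𝔪₀² ⇒ dim_K A ⧸ (J + 𝔪₀ᴺ) ≤ 1` for every `N`. OURS (elementary).
[cite: AtiyahMacdonald1969, Prop. 2.6 / Cor. 2.7 (Nakayama's lemma)] -/
theorem finrank_quotient_le_one_of_le_sup_sq {J : Ideal (MvPolynomial (Fin 4) K)}
    (hm : originIdeal K ≤ J ⊔ originIdeal K ^ 2) (N : ℕ) :
    Module.finrank K (MvPolynomial (Fin 4) K ⧸ (J ⊔ originIdeal K ^ N)) ≤ 1 := by
  cases N with
  | zero => rw [finrank_quotient_sup_pow_zero]; exact Nat.zero_le 1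
  | succ n =>
    refine finrank_quotient_le_of_X_pow_mem (j := 0) (hm.trans (sup_le_sup_right le_sup_right _)) ?_
    rw [pow_one]
    exact originIdeal_le_sup_pow_succ_of_le_sup_sq hm n (IsolatedScope.X_mem_originIdeal 0)

/-- **Lower bound.** If `J ≤ 𝔪₀`, `𝔪₀ ≰ J + 𝔪₀²` (positive embedding dimension) and `N` is a certificate
level (`𝔪₀ᴺ ≤ J + 𝔪₀ᴺ⁺¹`), then `2 ≤ dim_K A ⧸ (J + 𝔪₀ᴺ)` (levels `0, 1` are not certificate levels,
so `N ≥ 2` and the colength at `2` is already `≥ 2`). OURS (elementary).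
[cite: AtiyahMacdonald1969, Prop. 6.9 (length is additive)] -/
theorem two_le_finrank_quotient_of_certificate {J : Ideal (MvPolynomial (Fin 4) K)}
    (hJ : J ≤ originIdeal K) (hne : ¬ originIdeal K ≤ J ⊔ originIdeal K ^ 2) {N : ℕ}
    (hN : originIdeal K ^ N ≤ J ⊔ originIdeal K ^ (N + 1)) :
    2 ≤ Module.finrank K (MvPolynomial (Fin 4) K ⧸ (J ⊔ originIdeal K ^ N)) := by
  have hno : ∀ k, k < 2 → ¬ originIdeal K ^ k ≤ J ⊔ originIdeal K ^ (k + 1) := by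
    intro k hk h
    interval_cases k
    · rw [pow_zero, Ideal.one_eq_top, zero_add, pow_one, sup_eq_right.mpr hJ, top_le_iff] at h
      exact originIdeal_ne_top K h
    · rw [pow_one] at h
      exact hne h
  have h2N : 2 ≤ N := by
    by_contra hlt
    exact hno N (not_le.mp hlt) hN
  have h2 := le_finrank_of_forall_not_certificate J 2 hno
  have hmono : Module.finrank K (MvPolynomial (Fin 4) K ⧸ (J ⊔ originIdeal K ^ 2)) ≤
      Module.finrank K (MvPolynomial (Fin 4) K ⧸ (J ⊔ originIdeal K ^ N)) :=
    finrank_quotient_le_of_le (n := N) le_sup_right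
      (sup_le_sup_left (Ideal.pow_le_pow_right h2N) J)
  exact h2.trans hmono

/-! ## §3 Division by `x_j` against `𝔪₀ᴹ` -/

/-- `x_j · h ∈ 𝔪₀ᴹ⁺¹ ⇒ h ∈ 𝔪₀ᴹ` (`𝔪₀ᴹ` is the monomial ideal of degrees `≥ M`). OURS (bookkeeping).
[cite: AtiyahMacdonald1969, Ch. 1 Ex. 1.1 (the ideal (x₁,…,xₙ))] -/
theorem mem_originIdeal_pow_of_X_mul_mem {j : Fin 4} {h : MvPolynomial (Fin 4) K} {M : ℕ}
    (hx : X j * h ∈ originIdeal K ^ (M + 1)) : h ∈ originIdeal K ^ M := by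
  rw [mem_originIdeal_pow_iff] at hx ⊢
  intro d hd
  have := hx (Finsupp.single j 1 + d) (by
    rw [map_add, Finsupp.degree_single]; omega)
  rwa [coeff_X_mul] at this

/-- **`x_jᵏ⁺¹ ∈ x_j·J + 𝔪₀ᴹ⁺¹ ⇒ x_jᵏ ∈ J + 𝔪₀ᴹ`** — the step between the pullback containment (L2:
`J⁺(F)` pulls back into `x_j · J⁺(F')`) and the colength comparison of (N1⁺). OURS (bookkeeping).
[cite: AtiyahMacdonald1969, Ch. 1 Ex. 1.1 (the ideal (x₁,…,xₙ))] -/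
theorem X_pow_mem_sup_pow_of_succ_mem {J : Ideal (MvPolynomial (Fin 4) K)} {j : Fin 4} {k M : ℕ}
    (h : (X j : MvPolynomial (Fin 4) K) ^ (k + 1) ∈
      Ideal.span {(X j : MvPolynomial (Fin 4) K)} * J ⊔ originIdeal K ^ (M + 1)) :
    (X j : MvPolynomial (Fin 4) K) ^ k ∈ J ⊔ originIdeal K ^ M := by
  obtain ⟨u, hu, v, hv, huv⟩ := Submodule.mem_sup.mp h
  obtain ⟨z, hz, rfl⟩ := Ideal.mem_span_singleton_mul.mp hu
  have hv' : X j * ((X j : MvPolynomial (Fin 4) K) ^ k - z) ∈ originIdeal K ^ (M + 1) := by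
    have : X j * ((X j : MvPolynomial (Fin 4) K) ^ k - z) = v := by
      rw [mul_sub, ← pow_succ', ← huv]; ring
    rw [this]; exact hv
  have : (X j : MvPolynomial (Fin 4) K) ^ k = z + ((X j : MvPolynomial (Fin 4) K) ^ k - z) := by ring
  rw [this]
  exact Submodule.add_mem_sup hz (mem_originIdeal_pow_of_X_mul_mem hv')

/-- Variant with the hypothesis at every level: `(∀ M, x_jᵏ⁺¹ ∈ x_j·J + 𝔪₀ᴹ) ⇒ ∀ M, x_jᵏ ∈ J + 𝔪₀ᴹ`.
OURS (bookkeeping). [cite: AtiyahMacdonald1969, Ch. 1 Ex. 1.1 (the ideal (x₁,…,xₙ))] -/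
theorem forall_X_pow_mem_sup_pow_of_succ_mem {J : Ideal (MvPolynomial (Fin 4) K)} {j : Fin 4} {k : ℕ}
    (h : ∀ M : ℕ, (X j : MvPolynomial (Fin 4) K) ^ (k + 1) ∈
      Ideal.span {(X j : MvPolynomial (Fin 4) K)} * J ⊔ originIdeal K ^ M) (M : ℕ) :
    (X j : MvPolynomial (Fin 4) K) ^ k ∈ J ⊔ originIdeal K ^ M :=
  X_pow_mem_sup_pow_of_succ_mem (h (M + 1))

/-! ## §4 The same in `μ⁺`-vocabulary (`RidgeBudget.jetColength` / `IsCert`) -/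

/-- `IsCert` is upward closed in the level. OURS (bookkeeping; `certificate_mono`).
[cite: AtiyahMacdonald1969, Ch. 1 (operations on ideals)] -/
theorem isCert_mono {q N M : ℕ} {F : MvPolynomial (Fin 4) K} (h : IsCert q N F) (hM : N ≤ M) :
    IsCert q M F :=
  certificate_mono h hM

/-- **`μ⁺` is constant above a certificate level.** OURS (bookkeeping; `finrank_quotient_eq_of_certificate`).
[cite: AtiyahMacdonald1969, Prop. 6.9 (length is additive)] -/
theorem jetColength_eq_of_isCert {q N M : ℕ} {F : MvPolynomial (Fin 4) K} (h : IsCert q N F)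
    (hM : N ≤ M) : jetColength q M F = jetColength q N F :=
  finrank_quotient_eq_of_certificate h hM

/-- **`μ⁺` does not depend on the certificate level**: two certificate levels give the same
`jetColength`. OURS (bookkeeping). [cite: AtiyahMacdonald1969, Prop. 6.9 (length is additive)] -/
theorem jetColength_eq_of_isCert_of_isCert {q N N' : ℕ} {F : MvPolynomial (Fin 4) K}
    (h : IsCert q N F) (h' : IsCert q N' F) : jetColength q N F = jetColength q N' F := by
  rcases le_total N N' with hle | hle
  · exact (jetColength_eq_of_isCert h hle).symm
  · exact jetColength_eq_of_isCert h' hle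

/-- `μ⁺` is non-decreasing in the level (before it stabilises). OURS (bookkeeping).
[cite: AtiyahMacdonald1969, Prop. 6.9 (length is additive)] -/
theorem jetColength_le_succ (q N : ℕ) (F : MvPolynomial (Fin 4) K) :
    jetColength q N F ≤ jetColength q (N + 1) F :=
  finrank_quotient_sup_pow_mono _ N

/-- **`N⁺ ≤ μ⁺`**: at a certificate level, `μ⁺` itself is a certificate level. OURS (bookkeeping;
`certificate_at_finrank`). [cite: AtiyahMacdonald1969, Prop. 6.9 (length is additive)] -/
theorem isCert_jetColength {q N : ℕ} {F : MvPolynomial (Fin 4) K} (h : IsCert q N F) :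
    IsCert q (jetColength q N F) F :=
  certificate_at_finrank h

/-- Isolated ⇒ some certificate level exists (p-14's `IsolationConverse.exists_certificate_of_isIsolated`
in `IsCert` spelling). OURS (bookkeeping). [cite: AtiyahMacdonald1969, Prop. 4.8 / Cor. 7.16 (primary components at an isolated prime via localisation)] -/
theorem exists_isCert_of_isIsolated {q : ℕ} {F : MvPolynomial (Fin 4) K} (h : IsIsolated q F) :
    ∃ N, IsCert q N F :=
  IsolationConverse.exists_certificate_of_isIsolated h

/-- A certificate level (with `J_q⁺(F) ≤ 𝔪₀`) ⇒ isolated (PR-10 in `IsCert` spelling). OURS (bookkeeping).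
[cite: AtiyahMacdonald1969, Prop. 2.6 / Cor. 2.7 (Nakayama's lemma)] -/
theorem isIsolated_of_isCert {q N : ℕ} {F : MvPolynomial (Fin 4) K}
    (hJ : singLocusIdeal q F ≤ originIdeal K) (h : IsCert q N F) : IsIsolated q F :=
  isIsolated_of_pow_le_sup_pow_succ hJ h

/-- **SPAN LEMMA, `μ⁺` form**: `𝔪₀ ≤ (x_j) + J_q⁺(F) + 𝔪₀²` and `x_jᵏ ∈ J_q⁺(F) + 𝔪₀ᴺ` give
`μ⁺ = jetColength q N F ≤ k`. OURS (elementary). [cite: AtiyahMacdonald1969, Prop. 2.6 / Cor. 2.7 (Nakayama's lemma)] -/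
theorem jetColength_le_of_X_pow_mem {q N k : ℕ} {F : MvPolynomial (Fin 4) K} {j : Fin 4}
    (hm : originIdeal K ≤
      Ideal.span {(X j : MvPolynomial (Fin 4) K)} ⊔ singLocusIdeal q F ⊔ originIdeal K ^ 2)
    (hk : (X j : MvPolynomial (Fin 4) K) ^ k ∈ singLocusIdeal q F ⊔ originIdeal K ^ N) :
    jetColength q N F ≤ k :=
  finrank_quotient_le_of_X_pow_mem hm hk

/-- **`ē = 0` form**: `𝔪₀ ≤ J_q⁺(F) + 𝔪₀²` gives `jetColength q N F ≤ 1` at every level. OURS (elementary).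
[cite: AtiyahMacdonald1969, Prop. 2.6 / Cor. 2.7 (Nakayama's lemma)] -/
theorem jetColength_le_one_of_le_sup_sq {q : ℕ} {F : MvPolynomial (Fin 4) K}
    (hm : originIdeal K ≤ singLocusIdeal q F ⊔ originIdeal K ^ 2) (N : ℕ) : jetColength q N F ≤ 1 :=
  finrank_quotient_le_one_of_le_sup_sq hm N

/-- **`μ⁺ ≥ 2` at positive embedding dimension**: `J_q⁺(F) ≤ 𝔪₀`, `𝔪₀ ≰ J_q⁺(F) + 𝔪₀²`, and a
certificate level `N` give `2 ≤ jetColength q N F`. OURS (elementary).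
[cite: AtiyahMacdonald1969, Prop. 6.9 (length is additive)] -/
theorem two_le_jetColength {q N : ℕ} {F : MvPolynomial (Fin 4) K}
    (hJ : singLocusIdeal q F ≤ originIdeal K)
    (hne : ¬ originIdeal K ≤ singLocusIdeal q F ⊔ originIdeal K ^ 2) (h : IsCert q N F) :
    2 ≤ jetColength q N F :=
  two_le_finrank_quotient_of_certificate hJ hne h

/-! ## §5 (APPEND) `x_j^{μ⁺} ∈ J_q⁺ + 𝔪₀ᴹ` WITHOUT the ridge: nilpotency in `A ⧸ (J + 𝔪₀ᴺ)` -/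

/-- **Every `g ∈ 𝔪₀` satisfies `g^{dim} ∈ J + 𝔪₀ᴺ`, `dim = dim_K A ⧸ (J + 𝔪₀ᴺ)`** — no certificate, no
curvilinearity: `ḡᴺ = 0` in the finite-dimensional `K`-algebra `A ⧸ (J + 𝔪₀ᴺ)`, so left multiplication
by `ḡ` is a nilpotent endomorphism and its kernel chain is stationary from the dimension on
(Mathlib `Module.End.ker_pow_le_ker_pow_finrank`), whence `ḡ^{dim} = ḡ^{dim}·1 = 0`. OURS (linear algebra).
[cite: AtiyahMacdonald1969, Prop. 6.9 (length is additive)] -/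
theorem pow_finrank_mem_sup_pow {J : Ideal (MvPolynomial (Fin 4) K)} {N : ℕ}
    {g : MvPolynomial (Fin 4) K} (hg : g ∈ originIdeal K) :
    g ^ Module.finrank K (MvPolynomial (Fin 4) K ⧸ (J ⊔ originIdeal K ^ N)) ∈
      J ⊔ originIdeal K ^ N := by
  set I : Ideal (MvPolynomial (Fin 4) K) := J ⊔ originIdeal K ^ N with hI
  haveI : Module.Finite K (MvPolynomial (Fin 4) K ⧸ I) :=
    moduleFinite_quotient_of_originIdeal_pow_le (n := N) le_sup_right
  set b : MvPolynomial (Fin 4) K ⧸ I := Ideal.Quotient.mk I g with hb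
  have hbN : b ^ N = 0 := by
    rw [hb, ← map_pow]
    exact Ideal.Quotient.eq_zero_iff_mem.mpr (Submodule.mem_sup_right (Ideal.pow_mem_pow hg N))
  have h1 : (1 : MvPolynomial (Fin 4) K ⧸ I) ∈ LinearMap.ker (LinearMap.mulLeft K b ^ N) := by
    rw [LinearMap.pow_mulLeft, LinearMap.mem_ker, LinearMap.mulLeft_apply, hbN, zero_mul]
  have h2 := Module.End.ker_pow_le_ker_pow_finrank (LinearMap.mulLeft K b) N h1
  rw [LinearMap.pow_mulLeft, LinearMap.mem_ker, LinearMap.mulLeft_apply, mul_one] at h2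
  rw [← Ideal.Quotient.eq_zero_iff_mem, map_pow]
  exact h2

/-- **At a certificate level the same holds at EVERY level `M`**: `𝔪₀ᴺ ≤ J + 𝔪₀ᴺ⁺¹`, `g ∈ 𝔪₀` ⇒
`g^{dim_K A ⧸ (J + 𝔪₀ᴺ)} ∈ J + 𝔪₀ᴹ` for all `M` (the filtration is stationary from `N` on,
`sup_pow_eq_of_certificate`; below `N` the ideal only grows). OURS (bookkeeping).
[cite: AtiyahMacdonald1969, Prop. 6.9 (length is additive)] -/
theorem pow_finrank_mem_sup_pow_of_certificate {J : Ideal (MvPolynomial (Fin 4) K)} {N : ℕ}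
    (hN : originIdeal K ^ N ≤ J ⊔ originIdeal K ^ (N + 1)) {g : MvPolynomial (Fin 4) K}
    (hg : g ∈ originIdeal K) (M : ℕ) :
    g ^ Module.finrank K (MvPolynomial (Fin 4) K ⧸ (J ⊔ originIdeal K ^ N)) ∈
      J ⊔ originIdeal K ^ M := by
  rcases le_total N M with h | h
  · rw [sup_pow_eq_of_certificate hN h]
    exact pow_finrank_mem_sup_pow hg
  · exact (sup_le_sup_left (Ideal.pow_le_pow_right h) J) (pow_finrank_mem_sup_pow hg)

/-- **`x_j^{μ⁺} ∈ J_q⁺(F) + 𝔪₀ᴹ` for every `j` and every `M`** at any certificate level `N`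
(`μ⁺ = jetColength q N F`) — L1 conjunct 2 of the (N1) narrow line, for free. OURS (bookkeeping).
[cite: AtiyahMacdonald1969, Prop. 6.9 (length is additive)] -/
theorem X_pow_jetColength_mem {q N : ℕ} {F : MvPolynomial (Fin 4) K} (h : IsCert q N F) (j : Fin 4)
    (M : ℕ) :
    (X j : MvPolynomial (Fin 4) K) ^ jetColength q N F ∈ singLocusIdeal q F ⊔ originIdeal K ^ M :=
  pow_finrank_mem_sup_pow_of_certificate h (IsolatedScope.X_mem_originIdeal j) M

end Summit.ResolutionOfSingularities.ResolutionOfSingularities.Theorems.PIDim4.RidgeBudget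

end
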